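import Summits.BirchSwinnertonDyer.BirchSwinnertonDyer.Theorems.ByReductionTypeAtTwoAdditivePotMultConjATwoAdmissibleCarriers
import Summits.BirchSwinnertonDyer.BirchSwinnertonDyer.Theorems.ByReductionTypeAtTwoAdditivePotMultConjATwoCubicFieldDoor
import Summits.BirchSwinnertonDyer.BirchSwinnertonDyer.Theorems.ByReductionTypeAtTwoFineSelmerConjAAtTwoAdditivePotGoodHeart
import Literature.NumberTheory.EllipticCurves.NonEisensteinPrimeOfSurjective
import HarnessLib

/-!
# C1″ `FineSelmerConjAAtTwoAdditivePotGood` (item stmt-BirchSwinnertonDyer-22615) from NUMBER-FIELD statements on the cubic `2`-division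
# field `ℚ(x(T))` — the route decl BY NAME, KERNEL doors, general (globally minimal) models, no `hLim2`: sign-free from `μ₂ = 0` of the
# sextic `ℚ(x(T), √−1)`, and split by the sign of `Δ` into «`μ₂(ℚ(x(T))^cyc) = 0`» (`Δ < 0`) ∧ «NARROW `μ₂(ℚ(x(T))^cyc) = 0`» (`0 < Δ`)

Cell `bsd-2adic`, seat `bsd-2adic-k4-w3` GEN 10 (explicit unit (309)(7)); a `--supports 22615` file — the by-name consequence for C1″ of this
seat's general-model doors (GEN 9 `…AdditivePotMultConjATwoCubicFieldDoor`, GEN 10 `…ConjATwoTorsionPointFieldDoor` / `…ConjATwoAdmissibleCarriers`), flagged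
by GEN 9 («C1″'s binder `hAna` admits the same split with `0 ≤ ord₂ j`»). The named-curve ROWS of C1″ stay with k4-w1 / k4-w2 (RC-472/481);
this file is the `∀`-level binder only. HONEST FRAMING (D-0036/D-0054): THEOREMS ONLY — no definition, no named fact, no `sorry`; every
theorem is an IMPLICATION into the route decl from an OPEN number-field statement (Iwasawa's `μ₂ = 0`, plain or narrow, for non-abelian
cubic / sextic fields); C1″ is NOT closed; nothing booked; BSD is not proved by any of this.

WHY. C1″ = v11's binder `hAna` VERBATIM (Coates–Sujatha's (A) at `(W, 2)` for the non-CM, analytic-rank-`0`, additive potentially GOOD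
curves with non-abelian `ℚ(W[2])`). k4-w1's `…Heart` priced it as «`μ₂ = 0` for the `S₃`-sextics `ℚ(W[2])`» modulo {`hLim2`, h416, hI};
w2 GEN 6–8 made the (A)₂-from-`μ` doors KERNEL (p718233 sextic carrier `ℚ(P, √−1)`; p728213 cubic carrier on `disc < 0`; p734295 Kida-lite
narrow ascent); this seat typed them for general models in the `β = x(T)` currency. Non-abelian `ℚ(W[2])` ⟺ `ρ̄_{W,2}` onto
(`not_isAbelianGalois_divisionField_two_iff_hasSurjectiveModNGaloisRep`) ⟹ `W[2]` irreducible.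

* `fineSelmerConjAAtTwoAdditivePotGood_of_cubicFieldAdjoinIMu` — C1″ ⟸ ONE sign-free statement «`μ₂ = 0` for the cyclotomic `ℤ₂`-extension
  of `ℚ(x(T), √−1)`» over the C1″ curves.
* `fineSelmerConjAAtTwoAdditivePotGood_of_cubicFieldNarrowMu` — C1″ ⟸ «NARROW `μ₂(ℚ(x(T))) = 0`» ((a) ∧ (b)), sign-free.
* `conjA_two_additivePotGood_negDisc_of_cubicFieldMu` / `…_posDisc_of_cubicFieldNarrowMu` / `…_posDisc_of_exists_admissibleCarrierMu` —
  the two halves, the `0 < Δ` one also from «`μ₂ = 0` for SOME admissible sextic carrier `ℚ(x(T), x)`, `x² ∈ {−1, −2, −Δ, −2Δ}`» (GEN 10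
  `…ConjATwoAdmissibleCarriers`; aimed at k4-w1's seven «hLim2-alone» `0 < Δ` rows, e.g. 100560c1 where `h(ℚ(θ, √−1))` is even);
  `fineSelmerConjAAtTwoAdditivePotGood_of_cubicFieldMu_of_exists_admissibleCarrierMu`;
  **`fineSelmerConjAAtTwoAdditivePotGood_of_cubicFieldMu_of_cubicFieldNarrowMu`** — C1″ BY NAME ⟸ {`μ₂(ℚ(x(T))^cyc) = 0` on the `Δ < 0`
  curves} ∧ {narrow `μ₂(ℚ(x(T))^cyc) = 0` on the `0 < Δ` curves}: cubic-field data only, no `hLim2`, no class-group datum displayed.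

References: [CoatesSujatha2005] Conj. A, Thm. 3.4; [Lim2017FineSelmer] §3 Thm. 3.5, Lemma 3.2; [LimSujatha2018] §3 Prop. 3.2;
[Kida1982JFields] (μ-part, shape); [Iwasawa1973MuInvariants] Thm. 2/3; [SilvermanAEC2009] III.§7, VIII.§1; [DokchitserDokchitserMathZ2012]
Theorem (1); tree p650571 (k4-w1 Heart), p718233 / p728213 / p734295 (w2), p733022 (GEN 9), `…TorsionPointFieldDoor` (GEN 10).
-/

set_option autoImplicit false
-- the Theorems namespace of this sub repeats the summit name by design (D-0017 nested layout)
set_option linter.dupNamespace false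

noncomputable section

open scoped Classical NumberField Polynomial IntermediateField
open NumberField Field Polynomial IntermediateField

namespace Summit.BirchSwinnertonDyer.BirchSwinnertonDyer.Theorems.AddKatoTwo

open WeierstrassCurve Literature.NumberTheory.EllipticCurves Literature.NumberTheory.EllipticCurves.ZpExtension
  Literature.NumberTheory.GaloisRepresentations Literature.NumberTheory.IwasawaTheory Literature.NumberTheory.NumberFields
  Literature.NumberTheory.EllipticCurves.Rank1Residual
  Summit.BirchSwinnertonDyer.BirchSwinnertonDyer.Theses.ByReductionTypeAtTwo

/-- Non-abelian `ℚ(W[2])` ⟹ irreducible `W[2]` (`ρ̄_{W,2}` onto `Aut(W[2]) ≅ S₃`). [cite: SilvermanAEC2009, III.§7 and VIII.§1] -/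
private theorem hasIrreducibleModPGaloisRep_two_of_not_isAbelianGalois (W : WeierstrassCurve ℚ) [W.IsElliptic]
    (hab : ¬ IsAbelianGalois ℚ (W.divisionField 2)) : W.HasIrreducibleModPGaloisRep 2 := by
  haveI : Fact (Nat.Prime 2) := ⟨Nat.prime_two⟩
  exact hasIrreducibleModPGaloisRep_of_hasSurjectiveModNGaloisRep W 2
    ((not_isAbelianGalois_divisionField_two_iff_hasSurjectiveModNGaloisRep W).mp hab)

/-! ## §1 C1″ from ONE sign-free number-field statement -/

/-- **C1″ `FineSelmerConjAAtTwoAdditivePotGood` BY NAME from «`μ₂ = 0` for the cyclotomic `ℤ₂`-extension of the sextic `ℚ(x(T), √−1)`».**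
If for every globally minimal, non-CM, analytic-rank-`0` curve `W`, additive and potentially good at `2` (`0 ≤ ord₂ j`) with non-abelian
`ℚ(W[2])`, every root `β` of its `2`-division cubic and every `i` with `i² = −1`, the cyclotomic `ℤ₂`-extensions of `ℚ⟮β⟯ ⊔ ℚ⟮i⟯` have
classical `μ = 0`, then C1″ holds. GEN 10's `conjA_two_of_classicalMu_cubicField_adjoin_I` pointwise. The hypothesis is OPEN; nothing asserted.
[cite: CoatesSujatha2005, Conj. A and Thm. 3.4] [cite: Lim2017FineSelmer, §3 Thm. 3.5 and Lemma 3.2] -/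
theorem fineSelmerConjAAtTwoAdditivePotGood_of_cubicFieldAdjoinIMu
    (hμ6 : ∀ (W : WeierstrassCurve ℚ) [W.IsElliptic] [W.IsGloballyMinimal], ¬ W.HasCM → W.analyticRank = 0 →
      Addv W 2 → 0 ≤ padicValRat 2 W.j → ¬ IsAbelianGalois ℚ (W.divisionField 2) →
      ∀ β : AlgebraicClosure ℚ, aeval β W.twoTorsionPolynomial.toPoly = 0 →
      ∀ i : AlgebraicClosure ℚ, i ^ 2 = -1 →
      ∀ κF : ZpExtension ↥(IntermediateField.adjoin ℚ ({β} : Set (AlgebraicClosure ℚ)) ⊔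
          IntermediateField.adjoin ℚ ({i} : Set (AlgebraicClosure ℚ))) 2, κF.IsCyclotomic → ClassicalMuVanishes κF) :
    FineSelmerConjAAtTwoAdditivePotGood := by
  intro W _ _ hcm hr hadd hj hab κ hκ
  obtain ⟨β, hβ⟩ := exists_aeval_twoTorsionPolynomial_eq_zero W
  obtain ⟨i, hi⟩ := IsAlgClosed.exists_pow_nat_eq (-1 : AlgebraicClosure ℚ) two_pos
  exact conjA_two_of_classicalMu_cubicField_adjoin_I W hβ hi (hμ6 W hcm hr hadd hj hab β hβ i hi) κ hκ

/-- **C1″ BY NAME from «NARROW `μ₂ = 0` of the cubic field `ℚ(x(T))`», sign-free**: (a) classical `μ = 0` and (b) bounded narrow defect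
`ord₂ h⁺(ℚ(β)_n) ≤ ord₂ h(ℚ(β)_n) + D` along the cyclotomic `ℤ₂`-tower of `ℚ⟮β⟯`, for every C1″ curve and every root `β` ⟹ C1″.
GEN 10's `conjA_two_of_narrowMu_cubicField` pointwise (irreducible `W[2]` from the non-abelian guard). OPEN; nothing asserted.
[cite: CoatesSujatha2005, Conj. A and Thm. 3.4] [cite: Kida1982JFields, main theorem (μ-part; shape only)] -/
theorem fineSelmerConjAAtTwoAdditivePotGood_of_cubicFieldNarrowMu
    (hμ3n : ∀ (W : WeierstrassCurve ℚ) [W.IsElliptic] [W.IsGloballyMinimal], ¬ W.HasCM → W.analyticRank = 0 →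
      Addv W 2 → 0 ≤ padicValRat 2 W.j → ¬ IsAbelianGalois ℚ (W.divisionField 2) →
      ∀ β : AlgebraicClosure ℚ, aeval β W.twoTorsionPolynomial.toPoly = 0 →
      (∀ κP : ZpExtension ↥(IntermediateField.adjoin ℚ ({β} : Set (AlgebraicClosure ℚ))) 2,
          κP.IsCyclotomic → ClassicalMuVanishes κP) ∧
      ∃ D : ℕ, ∀ κP : ZpExtension ↥(IntermediateField.adjoin ℚ ({β} : Set (AlgebraicClosure ℚ))) 2, κP.IsCyclotomic → ∀ n : ℕ,
        ∀ [NumberField ↥(κP.layer n)],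
        padicValNat 2 (narrowClassNumber ↥(κP.layer n)) ≤ padicValNat 2 (classNumber ↥(κP.layer n)) + D) :
    FineSelmerConjAAtTwoAdditivePotGood := by
  intro W _ _ hcm hr hadd hj hab κ hκ
  obtain ⟨β, hβ⟩ := exists_aeval_twoTorsionPolynomial_eq_zero W
  obtain ⟨hμ, D, hδ⟩ := hμ3n W hcm hr hadd hj hab β hβ
  exact conjA_two_of_narrowMu_cubicField W (hasIrreducibleModPGaloisRep_two_of_not_isAbelianGalois W hab) hβ hμ D hδ κ hκ

/-! ## §2 The split by the sign of `Δ` -/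

/-- **The `Δ < 0` half of C1″ from «`μ₂ = 0` for the cyclotomic `ℤ₂`-extension of the cubic field `ℚ(x(T))`»** (complex cubic, one real
place): GEN 9's general-model door `conjA_two_of_classicalMu_cubicField_of_Δ_neg_of_isGloballyMinimal` pointwise. OPEN; nothing asserted.
[cite: CoatesSujatha2005, Conj. A and Thm. 3.4] [cite: Iwasawa1973MuInvariants, Thm. 2 and Thm. 3] [cite: LimSujatha2018, §3 Prop. 3.2] -/
theorem conjA_two_additivePotGood_negDisc_of_cubicFieldMu
    (hμ3 : ∀ (W : WeierstrassCurve ℚ) [W.IsElliptic] [W.IsGloballyMinimal], ¬ W.HasCM → W.analyticRank = 0 →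
      Addv W 2 → 0 ≤ padicValRat 2 W.j → ¬ IsAbelianGalois ℚ (W.divisionField 2) → W.Δ < 0 →
      ∀ β : AlgebraicClosure ℚ, aeval β W.twoTorsionPolynomial.toPoly = 0 →
      ∀ κP : ZpExtension ↥(IntermediateField.adjoin ℚ ({β} : Set (AlgebraicClosure ℚ))) 2,
        κP.IsCyclotomic → ClassicalMuVanishes κP) :
    ∀ (W : WeierstrassCurve ℚ) [W.IsElliptic] [W.IsGloballyMinimal], ¬ W.HasCM → W.analyticRank = 0 →
      Addv W 2 → 0 ≤ padicValRat 2 W.j → ¬ IsAbelianGalois ℚ (W.divisionField 2) → W.Δ < 0 →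
      ∀ (κ : ZpExtension ℚ 2), κ.IsCyclotomic →
        ∃ (γ : Field.absoluteGaloisGroup ℚ) (D : W.FineSelmerDualData κ γ),
          Module.Finite ℤ_[2] (RestrictScalars ℤ_[2] (IwasawaAlgebra 2) D.X) := by
  intro W _ _ hcm hr hadd hj hab hΔ κ hκ
  obtain ⟨β, hβ⟩ := exists_aeval_twoTorsionPolynomial_eq_zero W
  exact conjA_two_of_classicalMu_cubicField_of_Δ_neg_of_isGloballyMinimal W hΔ
    (hasIrreducibleModPGaloisRep_two_of_not_isAbelianGalois W hab) hβ (hμ3 W hcm hr hadd hj hab hΔ β hβ) κ hκ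

/-- **The `0 < Δ` half of C1″ from «NARROW `μ₂ = 0` of the TOTALLY REAL cubic `ℚ(x(T))`»** ((a) ∧ (b) along its cyclotomic `ℤ₂`-tower):
GEN 10's `conjA_two_of_narrowMu_cubicField` pointwise. Greenberg-conjecture territory; OPEN; nothing asserted.
[cite: CoatesSujatha2005, Conj. A and Thm. 3.4] [cite: Kida1982JFields, main theorem (μ-part; shape only)] [cite: Washington1997, §13.3 Prop. 13.23] -/
theorem conjA_two_additivePotGood_posDisc_of_cubicFieldNarrowMu
    (hμ3p : ∀ (W : WeierstrassCurve ℚ) [W.IsElliptic] [W.IsGloballyMinimal], ¬ W.HasCM → W.analyticRank = 0 →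
      Addv W 2 → 0 ≤ padicValRat 2 W.j → ¬ IsAbelianGalois ℚ (W.divisionField 2) → 0 < W.Δ →
      ∀ β : AlgebraicClosure ℚ, aeval β W.twoTorsionPolynomial.toPoly = 0 →
      (∀ κP : ZpExtension ↥(IntermediateField.adjoin ℚ ({β} : Set (AlgebraicClosure ℚ))) 2,
          κP.IsCyclotomic → ClassicalMuVanishes κP) ∧
      ∃ D : ℕ, ∀ κP : ZpExtension ↥(IntermediateField.adjoin ℚ ({β} : Set (AlgebraicClosure ℚ))) 2, κP.IsCyclotomic → ∀ n : ℕ,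
        ∀ [NumberField ↥(κP.layer n)],
        padicValNat 2 (narrowClassNumber ↥(κP.layer n)) ≤ padicValNat 2 (classNumber ↥(κP.layer n)) + D) :
    ∀ (W : WeierstrassCurve ℚ) [W.IsElliptic] [W.IsGloballyMinimal], ¬ W.HasCM → W.analyticRank = 0 →
      Addv W 2 → 0 ≤ padicValRat 2 W.j → ¬ IsAbelianGalois ℚ (W.divisionField 2) → 0 < W.Δ →
      ∀ (κ : ZpExtension ℚ 2), κ.IsCyclotomic →
        ∃ (γ : Field.absoluteGaloisGroup ℚ) (D : W.FineSelmerDualData κ γ),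
          Module.Finite ℤ_[2] (RestrictScalars ℤ_[2] (IwasawaAlgebra 2) D.X) := by
  intro W _ _ hcm hr hadd hj hab hΔ κ hκ
  obtain ⟨β, hβ⟩ := exists_aeval_twoTorsionPolynomial_eq_zero W
  obtain ⟨hμ, D, hδ⟩ := hμ3p W hcm hr hadd hj hab hΔ β hβ
  exact conjA_two_of_narrowMu_cubicField W (hasIrreducibleModPGaloisRep_two_of_not_isAbelianGalois W hab) hβ hμ D hδ κ hκ

/-- **The `0 < Δ` half of C1″ from «`μ₂ = 0` for SOME admissible sextic carrier `ℚ(x(T), x)`, `x² ∈ {−1, −2, −Δ(W), −2Δ(W)}`»**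
(GEN 10's carrier widening, pointwise): four totally complex CM-sextics per curve to certify instead of one. OPEN inputs; nothing asserted.
[cite: CoatesSujatha2005, Conj. A and Thm. 3.4] [cite: Lim2017FineSelmer, §3 Thm. 3.5 and Lemma 3.2] -/
theorem conjA_two_additivePotGood_posDisc_of_exists_admissibleCarrierMu
    (hμx : ∀ (W : WeierstrassCurve ℚ) [W.IsElliptic] [W.IsGloballyMinimal], ¬ W.HasCM → W.analyticRank = 0 →
      Addv W 2 → 0 ≤ padicValRat 2 W.j → ¬ IsAbelianGalois ℚ (W.divisionField 2) → 0 < W.Δ →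
      ∀ β : AlgebraicClosure ℚ, aeval β W.twoTorsionPolynomial.toPoly = 0 →
      ∃ x : AlgebraicClosure ℚ, (x ^ 2 = -1 ∨ x ^ 2 = -2 ∨ x ^ 2 = -algebraMap ℚ (AlgebraicClosure ℚ) W.Δ ∨
          x ^ 2 = -2 * algebraMap ℚ (AlgebraicClosure ℚ) W.Δ) ∧
        ∀ κF : ZpExtension ↥(IntermediateField.adjoin ℚ ({β} : Set (AlgebraicClosure ℚ)) ⊔
            IntermediateField.adjoin ℚ ({x} : Set (AlgebraicClosure ℚ))) 2, κF.IsCyclotomic → ClassicalMuVanishes κF) :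
    ∀ (W : WeierstrassCurve ℚ) [W.IsElliptic] [W.IsGloballyMinimal], ¬ W.HasCM → W.analyticRank = 0 →
      Addv W 2 → 0 ≤ padicValRat 2 W.j → ¬ IsAbelianGalois ℚ (W.divisionField 2) → 0 < W.Δ →
      ∀ (κ : ZpExtension ℚ 2), κ.IsCyclotomic →
        ∃ (γ : Field.absoluteGaloisGroup ℚ) (D : W.FineSelmerDualData κ γ),
          Module.Finite ℤ_[2] (RestrictScalars ℤ_[2] (IwasawaAlgebra 2) D.X) := by
  intro W _ _ hcm hr hadd hj hab hΔ κ hκ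
  obtain ⟨β, hβ⟩ := exists_aeval_twoTorsionPolynomial_eq_zero W
  obtain ⟨x, hx, hμ⟩ := hμx W hcm hr hadd hj hab hΔ β hβ
  rcases hx with hx | hx | hx | hx
  · exact conjA_two_of_classicalMu_cubicField_adjoin_I W hβ hx hμ κ hκ
  · exact conjA_two_of_classicalMu_cubicField_adjoin_sqrt_neg_two W hβ hx hμ κ hκ
  · exact conjA_two_of_classicalMu_cubicField_adjoin_sqrt_neg_Δ W hΔ hβ hx hμ κ hκ
  · exact conjA_two_of_classicalMu_cubicField_adjoin_sqrt_neg_two_mul_Δ W hΔ hβ hx hμ κ hκ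

/-- **C1″ BY NAME from «`μ₂(ℚ(x(T))^cyc) = 0`» on the `Δ < 0` curves and «`μ₂ = 0` for SOME admissible sextic carrier» on the `0 < Δ`
curves.** KERNEL implication; OPEN inputs; C1″ is NOT closed by this. [cite: CoatesSujatha2005, Conj. A and Thm. 3.4]
[cite: Iwasawa1973MuInvariants, Thm. 2 and Thm. 3] [cite: LimSujatha2018, §3 Prop. 3.2] -/
theorem fineSelmerConjAAtTwoAdditivePotGood_of_cubicFieldMu_of_exists_admissibleCarrierMu
    (hμ3 : ∀ (W : WeierstrassCurve ℚ) [W.IsElliptic] [W.IsGloballyMinimal], ¬ W.HasCM → W.analyticRank = 0 →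
      Addv W 2 → 0 ≤ padicValRat 2 W.j → ¬ IsAbelianGalois ℚ (W.divisionField 2) → W.Δ < 0 →
      ∀ β : AlgebraicClosure ℚ, aeval β W.twoTorsionPolynomial.toPoly = 0 →
      ∀ κP : ZpExtension ↥(IntermediateField.adjoin ℚ ({β} : Set (AlgebraicClosure ℚ))) 2,
        κP.IsCyclotomic → ClassicalMuVanishes κP)
    (hμx : ∀ (W : WeierstrassCurve ℚ) [W.IsElliptic] [W.IsGloballyMinimal], ¬ W.HasCM → W.analyticRank = 0 →
      Addv W 2 → 0 ≤ padicValRat 2 W.j → ¬ IsAbelianGalois ℚ (W.divisionField 2) → 0 < W.Δ →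
      ∀ β : AlgebraicClosure ℚ, aeval β W.twoTorsionPolynomial.toPoly = 0 →
      ∃ x : AlgebraicClosure ℚ, (x ^ 2 = -1 ∨ x ^ 2 = -2 ∨ x ^ 2 = -algebraMap ℚ (AlgebraicClosure ℚ) W.Δ ∨
          x ^ 2 = -2 * algebraMap ℚ (AlgebraicClosure ℚ) W.Δ) ∧
        ∀ κF : ZpExtension ↥(IntermediateField.adjoin ℚ ({β} : Set (AlgebraicClosure ℚ)) ⊔
            IntermediateField.adjoin ℚ ({x} : Set (AlgebraicClosure ℚ))) 2, κF.IsCyclotomic → ClassicalMuVanishes κF) :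
    FineSelmerConjAAtTwoAdditivePotGood := by
  intro W _ _ hcm hr hadd hj hab κ hκ
  rcases lt_or_gt_of_ne W.isUnit_Δ.ne_zero with hΔ | hΔ
  · exact conjA_two_additivePotGood_negDisc_of_cubicFieldMu hμ3 W hcm hr hadd hj hab hΔ κ hκ
  · exact conjA_two_additivePotGood_posDisc_of_exists_admissibleCarrierMu hμx W hcm hr hadd hj hab hΔ κ hκ

/-- **C1″ `FineSelmerConjAAtTwoAdditivePotGood` BY NAME from CUBIC-FIELD DATA ONLY, split by the sign of `Δ`:** «`μ₂ = 0` for the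
cyclotomic `ℤ₂`-extension of `ℚ(x(T))`» on the `Δ < 0` curves and «NARROW `μ₂ = 0` ((a) ∧ (b)) for `ℚ(x(T))`» on the `0 < Δ` curves ⟹ C1″
(`Δ ≠ 0`). KERNEL implication — no `hLim2`, no class-group datum displayed; the two hypotheses are OPEN Iwasawa-`μ` statements for
non-abelian cubic fields (per-field decidable only by certificates: k4-w1 / k4-w2's row stamps); C1″ is NOT closed by this; no restate of
22615 is asked (D-0152). [cite: CoatesSujatha2005, Conj. A and Thm. 3.4] [cite: Iwasawa1973MuInvariants, Thm. 2 and Thm. 3]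
[cite: Kida1982JFields, main theorem (μ-part; shape only)] [cite: LimSujatha2018, §3 Prop. 3.2] -/
theorem fineSelmerConjAAtTwoAdditivePotGood_of_cubicFieldMu_of_cubicFieldNarrowMu
    (hμ3 : ∀ (W : WeierstrassCurve ℚ) [W.IsElliptic] [W.IsGloballyMinimal], ¬ W.HasCM → W.analyticRank = 0 →
      Addv W 2 → 0 ≤ padicValRat 2 W.j → ¬ IsAbelianGalois ℚ (W.divisionField 2) → W.Δ < 0 →
      ∀ β : AlgebraicClosure ℚ, aeval β W.twoTorsionPolynomial.toPoly = 0 →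
      ∀ κP : ZpExtension ↥(IntermediateField.adjoin ℚ ({β} : Set (AlgebraicClosure ℚ))) 2,
        κP.IsCyclotomic → ClassicalMuVanishes κP)
    (hμ3p : ∀ (W : WeierstrassCurve ℚ) [W.IsElliptic] [W.IsGloballyMinimal], ¬ W.HasCM → W.analyticRank = 0 →
      Addv W 2 → 0 ≤ padicValRat 2 W.j → ¬ IsAbelianGalois ℚ (W.divisionField 2) → 0 < W.Δ →
      ∀ β : AlgebraicClosure ℚ, aeval β W.twoTorsionPolynomial.toPoly = 0 →
      (∀ κP : ZpExtension ↥(IntermediateField.adjoin ℚ ({β} : Set (AlgebraicClosure ℚ))) 2,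
          κP.IsCyclotomic → ClassicalMuVanishes κP) ∧
      ∃ D : ℕ, ∀ κP : ZpExtension ↥(IntermediateField.adjoin ℚ ({β} : Set (AlgebraicClosure ℚ))) 2, κP.IsCyclotomic → ∀ n : ℕ,
        ∀ [NumberField ↥(κP.layer n)],
        padicValNat 2 (narrowClassNumber ↥(κP.layer n)) ≤ padicValNat 2 (classNumber ↥(κP.layer n)) + D) :
    FineSelmerConjAAtTwoAdditivePotGood := by
  intro W _ _ hcm hr hadd hj hab κ hκ
  rcases lt_or_gt_of_ne W.isUnit_Δ.ne_zero with hΔ | hΔ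
  · exact conjA_two_additivePotGood_negDisc_of_cubicFieldMu hμ3 W hcm hr hadd hj hab hΔ κ hκ
  · exact conjA_two_additivePotGood_posDisc_of_cubicFieldNarrowMu hμ3p W hcm hr hadd hj hab hΔ κ hκ

end Summit.BirchSwinnertonDyer.BirchSwinnertonDyer.Theorems.AddKatoTwo

end
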